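import Summits.HubbardSuperconductivity.HubbardSuperconductivity.Theorems.AnisotropyChordTransferFibre3N1RowTrueVec
import Summits.HubbardSuperconductivity.HubbardSuperconductivity.Theorems.AnisotropyChordTransferFibre3N1RowNamed
import Summits.HubbardSuperconductivity.HubbardSuperconductivity.Theorems.AnisotropyChordTransferFibre3ManifoldA
import Summits.HubbardSuperconductivity.HubbardSuperconductivity.Theorems.AnisotropyChordTransferFibre3TtailBounds
import Summits.HubbardSuperconductivity.HubbardSuperconductivity.Theorems.AnisotropyChordTransferFibre3GroundFormulas
import Summits.HubbardSuperconductivity.HubbardSuperconductivity.Theorems.AnisotropyChordTransferFibre3GreenZero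

/-!
# Route `AnisotropyChord` / H0 rotor rung, LEVEL 2 row `N₁`: the tail-block specs of the true vector (`TtSpecs`) and the DICTIONARY
at the true vector

`…N1RowTrueVec.xTrue_specs` takes the 48 tail-block inequalities `TtSpecs` as a hypothesis: for every grid momentum `q`
(`|q|∞ ≤ 3`, `q ≠ 0`), `ttLoE.eval X ≤ θ²t(q) ≤ ttHiE.eval X` with `ttLoE = −2ac_sĝ(q)ε`, `ttHiE = min(σ̂, 2c_su/(Ê(q)/2 − 2ν))`.
THIS FILE discharges it for a ground two-magnon profile (`L ≥ 12`, `0 ≤ Δ < 1`, `0 < λ₂`, `2λ₂ < ε₁`, `a := Δf(x̂)`) from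
`ttailBounds_holds` ((i) `t ≥ −2ac_sg/V`, (ii) `t ≤ ‖s‖²`, (iii) `t ≤ 2c_s²G̃(0)/(ε_T − 2λ₂)`) and the DICTIONARY AT THE TRUE VECTOR
(★ `dict_at_xTrue`: `eps ↦ 1/V`, `eta ↦ η_eff`, `cs ↦ c_s`, `uu ↦ c_sG̃(0)`, `dd ↦ a²`, `sig ↦ θ²‖s‖²`; from `manifold_dictionary`,
`sNormNamed_holds`, `Gres_zero_zero_eq_Gzero`), plus the grid bookkeeping `gridIdx_three` (`decide`).  Result: ★ `ttSpecs_holds`, and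
the hypothesis-free spec theorem ★ `xTrue_specs_ground`.
Prover seat `hubbard-h0-rotor-p2` g4; helper for piece A = stmt-HubbardSuperconductivity-23918 of rung 19089
(`--supports`, helper class).  Nothing here proves superconductivity in the Hubbard model; helper lemmas of ONE conditional
reduction (the GM₃ ∀L certificate, Level-2 row `N₁`); the rotor TARGET as originally worded stays FALSE (g15 verdict).
Mathlib + the tree only; no sorry.
-/

set_option linter.dupNamespace false
set_option autoImplicit false

open Literature.Analysis.ValidatedNumerics

namespace Summit.HubbardSuperconductivity.HubbardSuperconductivity.Theorems.AnisotropyChord.Transfer.Fibre3.L2.N1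

/-- grid bookkeeping: the index of the `i`-th grid point is `i`. -/
theorem gridIdx_three : ∀ i (hi : i < 48), gridIdx 3 ((gridPts 3)[i]'(by rw [length_gridPts_three]; exact hi)) = i := by
  decide

variable (L : ℕ) [NeZero L] (Δ lam2 : ℝ) (f : Tor L → ℝ)

/-! ## The dictionary at the true vector -/

/-- raw value of `cs` at any vector. -/
theorem eval_cs (x : ℕ → ℝ) : cs.eval x = 4 * (x 1 * x 2) * (1 + x 3 * (x 0 * (4 * x 1)⁻¹)) := by
  simp only [cs, eta, eps, RExpr.eval, cst, vT, vPi2, vNu, vA]; push_cast; ring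

/-- raw value of `dd` at any vector. -/
theorem eval_dd (x : ℕ → ℝ) : dd.eval x = x 3 ^ 2 := by
  simp only [dd, RExpr.eval, vA]

/-- raw value of `sig` at any vector. -/
theorem eval_sig (x : ℕ → ℝ) : sig.eval x = (cs.eval x ^ 2 * x 4 + dd.eval x * x 0 ^ 2) * (4 * x 1)⁻¹ := by
  simp only [sig, RExpr.eval, cst, vT, vPi2, vS2]; push_cast; ring

/-- ★ **DICTIONARY AT THE TRUE VECTOR** (`a := Δf(x̂)`, ground profile, `L ≥ 5`, `0 ≤ Δ < 1`, `0 < λ₂`):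
`eps ↦ 1/L²`, `cs ↦ c_s`, `uu ↦ c_s·G̃(0)`, `dd ↦ a²`, `sig ↦ θ²‖s‖²`. -/
theorem dict_at_xTrue (hL : 5 ≤ L) (hΔ0 : 0 ≤ Δ) (hΔ1 : Δ < 1) (hf : IsGroundTwoMagnon L Δ lam2 f) (hlam : 0 < lam2) :
    let X := xTrue L Δ lam2 f (Δ * f (K1 L))
    eps.eval X = 1 / (L : ℝ) ^ 2 ∧
    cs.eval X = cS L Δ lam2 f ∧
    uu.eval X = cS L Δ lam2 f * Gzero L lam2 ∧
    dd.eval X = (Δ * f (K1 L)) ^ 2 ∧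
    sig.eval X = (2 * Real.pi / L) ^ 2 * sNormSq L Δ f := by
  intro X
  have hLpos : (0 : ℝ) < L := by exact_mod_cast (show 0 < L by omega)
  have hπ := Real.pi_pos
  have hV : (0 : ℝ) < (L : ℝ) ^ 2 := by positivity
  obtain ⟨_, dcs, _, _, dG, _, dη⟩ := ManifoldA.manifold_dictionary L hL hΔ0 hΔ1 hf
  have hX0 : X 0 = (2 * Real.pi / L) ^ 2 := xTrue_zero L Δ lam2 f _
  have hX1 : X 1 = Real.pi ^ 2 := by
    show xTrue L Δ lam2 f _ 1 = _; rw [xTrue_lt16 L Δ lam2 f _ (by norm_num)]; rfl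
  have hX2 : X 2 = lam2 / (2 * Real.pi / L) ^ 2 := by
    show xTrue L Δ lam2 f _ 2 = _; rw [xTrue_lt16 L Δ lam2 f _ (by norm_num)]; rfl
  have hX3 : X 3 = Δ * f (K1 L) := by
    show xTrue L Δ lam2 f _ 3 = _; rw [xTrue_lt16 L Δ lam2 f _ (by norm_num)]; rfl
  have hX4 : X 4 = (2 * Real.pi / L) ^ (2 * 2) * S2n L lam2 := by
    show xTrue L Δ lam2 f _ 4 = _; rw [xTrue_lt16 L Δ lam2 f _ (by norm_num)]; rfl
  obtain ⟨eeps, euu⟩ := eval_eps_uu X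
  have ecs := eval_cs X
  have edd := eval_dd X
  have esig := eval_sig X
  -- `eps = 1/V`
  have hEps : X 0 * (4 * X 1)⁻¹ = 1 / (L : ℝ) ^ 2 := by
    rw [hX0, hX1]; field_simp; ring
  -- `cs = c_s`
  have hCs : cs.eval X = cS L Δ lam2 f := by
    rw [ecs, hEps, hX1, hX2, hX3, dcs, dη]; field_simp
  have hDd : dd.eval X = (Δ * f (K1 L)) ^ 2 := by rw [edd, hX3]
  refine ⟨by rw [eeps, hEps], hCs, ?_, hDd, ?_⟩
  · rw [euu, hEps, hX3, ← Gres_zero_zero_eq_Gzero, dG]; ring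
  · rw [esig, hCs, hDd, hX4, hX0, hX1, sNormNamed_holds L hL hΔ0 lam2 f hf hlam]
    unfold dPar
    have ht : (2 * Real.pi / (L : ℝ)) ^ 2 = 4 * Real.pi ^ 2 / (L : ℝ) ^ 2 := by rw [div_pow]; ring
    have ht4 : (2 * Real.pi / (L : ℝ)) ^ (2 * 2) = (4 * Real.pi ^ 2 / (L : ℝ) ^ 2) ^ 2 := by rw [pow_mul, ht]
    rw [ht4, ht]
    field_simp

/-! ## The tail-block specs -/

/-- values of the tail spec terms at any vector (`q` a grid point with index `gridIdx 3 q`). -/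
theorem eval_ttSpec (x : ℕ → ℝ) (q : ℤ × ℤ) :
    (ttLoE 3 q).eval x = -(2 * x 3 * cs.eval x * x (19 + gridIdx 3 q) * eps.eval x) ∧
    (ttHiE 3 q).eval x = min (sig.eval x)
      (2 * cs.eval x * uu.eval x * ((1 + x 2 * x (19 + gridIdx 3 q)) * (x (19 + gridIdx 3 q))⁻¹ * (1 / 2) - 2 * x 2)⁻¹) := by
  constructor
  · simp only [ttLoE, RExpr.eval, cst, vA, vG]; push_cast; ring
  · simp only [ttHiE, kapq, Eh, RExpr.eval, cst, vNu, vG]; push_cast; ring_nf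

/-- ★ **THE TAIL-BLOCK SPECS HOLD** for a ground profile with `L ≥ 12`, `0 ≤ Δ < 1`, `0 < λ₂`, `2λ₂ < ε₁`. -/
theorem ttSpecs_holds (hL : 12 ≤ L) (hΔ0 : 0 ≤ Δ) (hΔ1 : Δ < 1) (hf : IsGroundTwoMagnon L Δ lam2 f) (hlam : 0 < lam2)
    (h2 : 2 * lam2 < eps1 L) : TtSpecs L Δ lam2 f (Δ * f (K1 L)) := by
  intro i hi
  set X := xTrue L Δ lam2 f (Δ * f (K1 L)) with hXdef
  set θ : ℝ := 2 * Real.pi / L with hθdef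
  set q : ℤ × ℤ := (gridPts 3)[i]'(by rw [length_gridPts_three]; exact hi) with hqdef
  set k : Tor L := B1.toTor L q with hkdef
  have hLpos : (0 : ℝ) < L := by exact_mod_cast (show 0 < L by omega)
  have hπ := Real.pi_pos
  have hθ : 0 < θ := by positivity
  have hV : (0 : ℝ) < (L : ℝ) ^ 2 := by positivity
  -- `k ≠ 0`
  have hqW : q ∈ zWindow 3 := gridPts_three_window q (List.getElem_mem _)
  have hk : k ≠ 0 := by
    have := B1.intCast_ne_zero_of_mem_zWindow L 3 (by omega) q hqW
    simpa [hkdef, B1.toTor] using this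
  -- the three tail bounds
  obtain ⟨tlo, tsig, tkap⟩ := ttailBounds_holds L (by omega) hΔ0 lam2 f hf hlam h2 k hk
  -- dictionary
  obtain ⟨deps, dcs, duu, ddd, dsig⟩ := dict_at_xTrue L Δ lam2 f (by omega) hΔ0 hΔ1 hf hlam
  obtain ⟨elo, ehi⟩ := eval_ttSpec X q
  have hidx : gridIdx 3 q = i := gridIdx_three i hi
  have hXg : X (19 + i) = θ ^ 2 * gres L lam2 k := by rw [hXdef, xTrue_ghat L Δ lam2 f _ hi]
  have hXt : X (67 + i) = θ ^ 2 * tfun L Δ f k := by rw [hXdef, xTrue_tt L Δ lam2 f _ hi]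
  have hX2 : X 2 = lam2 / θ ^ 2 := by
    rw [hXdef, xTrue_lt16 L Δ lam2 f _ (by norm_num)]; rfl
  have hX3 : X 3 = Δ * f (K1 L) := by
    rw [hXdef, xTrue_lt16 L Δ lam2 f _ (by norm_num)]; rfl
  -- energies
  have hε1 : eps1 L ≤ epsT L k := eps1_le_epsT L (by omega) hk
  have hεpos : 0 < 2 * epsT L k - lam2 := by linarith
  have hε2 : 0 < epsT L k - 2 * lam2 := by linarith
  have hg : gres L lam2 k = 1 / (2 * epsT L k - lam2) := by unfold gres; rw [if_neg hk]
  have hgpos : 0 < gres L lam2 k := by rw [hg]; positivity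
  rw [hidx] at elo ehi
  constructor
  · -- lower: `−2ac_sĝε ≤ θ²t`
    rw [elo, hXt, hX3, dcs, hXg, deps]
    have : -(2 * (Δ * f (K1 L)) * cS L Δ lam2 f * (θ ^ 2 * gres L lam2 k) * (1 / (L : ℝ) ^ 2))
        = θ ^ 2 * (-(2 * Δ * f (K1 L) * cS L Δ lam2 f / (2 * epsT L k - lam2)) / (L : ℝ) ^ 2) := by
      rw [hg]; field_simp
    rw [this]
    exact mul_le_mul_of_nonneg_left tlo (by positivity)
  · -- upper: `θ²t ≤ min(σ̂, tκ_q)`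
    rw [ehi, hXt]
    refine le_min ?_ ?_
    · rw [dsig]
      unfold sNormSq at *
      exact mul_le_mul_of_nonneg_left tsig (by positivity)
    · rw [dcs, duu, hX2, hXg]
      -- `(1 + νĝ)/ĝ · ½ − 2ν = (ε − 2λ₂)/θ²`
      have hθ2 : θ ^ 2 ≠ 0 := by positivity
      have hE : (1 + lam2 / θ ^ 2 * (θ ^ 2 * gres L lam2 k)) * (θ ^ 2 * gres L lam2 k)⁻¹ * (1 / 2) - 2 * (lam2 / θ ^ 2)
          = (epsT L k - 2 * lam2) / θ ^ 2 := by
        rw [hg]; field_simp; ring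
      rw [hE]
      have : 2 * cS L Δ lam2 f * (cS L Δ lam2 f * Gzero L lam2) * ((epsT L k - 2 * lam2) / θ ^ 2)⁻¹
          = θ ^ 2 * (2 * cS L Δ lam2 f ^ 2 * Gzero L lam2 / (epsT L k - 2 * lam2)) := by
        field_simp
      rw [this]
      exact mul_le_mul_of_nonneg_left tkap (by positivity)

/-- ★★ **ALL SPECS HOLD AT THE TRUE VECTOR** (ground profile, `L ≥ 12`, `0 ≤ Δ < 1`, `0 < λ₂ < 4θ²/π²`, `2λ₂ < ε₁`,
`0 < 1 − a + a/V`, `0 ≤ a := Δf(x̂)`). -/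
theorem xTrue_specs_ground (hL : 12 ≤ L) (hΔ0 : 0 ≤ Δ) (hΔ1 : Δ < 1) (hf : IsGroundTwoMagnon L Δ lam2 f) (hlam : 0 < lam2)
    (h2 : 2 * lam2 < eps1 L) (hν : lam2 / (2 * Real.pi / L) ^ 2 < 4 / Real.pi ^ 2) (ha : 0 ≤ Δ * f (K1 L))
    (hu : 0 < 1 - Δ * f (K1 L) + Δ * f (K1 L) * ((2 * Real.pi / L) ^ 2 * (4 * Real.pi ^ 2)⁻¹)) :
    ∀ j (hj : j < (specs 2).length),
      ((specs 2)[j].1).eval (xTrue L Δ lam2 f (Δ * f (K1 L))) ≤ xTrue L Δ lam2 f (Δ * f (K1 L)) (16 + j) ∧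
      xTrue L Δ lam2 f (Δ * f (K1 L)) (16 + j) ≤ ((specs 2)[j].2).eval (xTrue L Δ lam2 f (Δ * f (K1 L))) := by
  have hLpos : (0 : ℝ) < L := by exact_mod_cast (show 0 < L by omega)
  have hν0 : 0 < lam2 / (2 * Real.pi / L) ^ 2 := by positivity
  exact xTrue_specs L Δ lam2 f _ hL hν0 hν ha hu (ttSpecs_holds L Δ lam2 f hL hΔ0 hΔ1 hf hlam h2)

end Summit.HubbardSuperconductivity.HubbardSuperconductivity.Theorems.AnisotropyChord.Transfer.Fibre3.L2.N1
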